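import Summits.Parity.GeneralizedHardyLittlewood.Theorems.LiouvilleMADEngineToGHLPairsReachTools

/-!
# Route LiouvilleMAD — crux `EngineToGHL` (stmt-Parity-14995): the exact reach of `PairsHL`
# inside Green–Tao's conjecture, and the crux as "reach ⟹ `DimOne`"

The crux is unconditionally `PairsHL → DicksonFibration.DimOne`
(`Theorems.EngineToGHL.engineToGHL_iff_pairsHL_imp_dimOne`, file `LiouvilleMADEngineToGHL.lean`),
where the hypothesis `PairsHL` (the route's own target, stmt-Parity-9387: for every FIXED `h ≥ 1`,
`∑_{n ≤ N} Λ(n)Λ(n+h) = 𝔖({0,h}) N + o(N)`) lives OUTSIDE the typed Green–Tao language of the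
conclusion.  This file places it inside, exactly:

* `pairsReach_of_pairsHL` (registered sub-goal of the line `Sketch`) — **`PairsHL` proves the
  Green–Tao asymptotic `|∑_{n ∈ K ∩ ℤ} Λ(ψ₁(n))Λ(ψ₂(n)) - β_∞ ∏_p β_p| ≤ ε N` for every unit-slope pair
  `ψᵢ(n) = n + bᵢ` with BOUNDED shift difference `|b₁ - b₀| ≤ H`, uniformly in `|bᵢ| ≤ L N`
  (`‖Ψ‖_N ≤ L`) and over ALL convex `K ⊆ [-N, N]`** — i.e. `DimOne` at `t = 2` restricted to unit
  slopes and bounded shift differences.  Proof: the section of `K` is an interval `J ⊆ [-N, N]`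
  (`ordConnected_section`), its integer points above `-min bᵢ` form a block `p, …, q`
  (`filter_Icc_mem_eq_Icc`), the weighted sum is the difference of the `PairsHL` partial sums at the
  two ends `q + min bᵢ`, `p + min bᵢ - 1 ≤ (L+1) N` (`vonMangoldtSum_unitSlopePair`,
  `sum_Icc_shift_eq`; `o(M)` made uniform as `δ M + C`, `pairsHL_uniform_bound`), the number of
  integer points is within `1` of the length `β_∞ = vol(J ∩ (-min bᵢ, ∞))`
  (`archFactor_unitSlopePair`, `abs_card_filter_sub_volume_le_one`), and `∏_p β_p = 𝔖({0, |b₁-b₀|})`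
  by translation invariance of the local factors over `ℤ/qℤ` (`localFactor_unitSlopePair`,
  `singularProduct_unitSlopePair`, over `PairsToGHL.singularSeries_pair_eq_singularProduct`);
* `pairsHL_of_pairsReach`, `pairsHL_iff_pairsReach` — conversely the reach statement contains
  `PairsHL` (system `(n, n+h)`, `K = [-N, N]`), so it is EQUIVALENT to it: nothing was lost;
* `pairsReach_of_dimOne` — and it is literally a sub-case of `DimOne` (stmt-Parity-0819);
* `engineToGHL_iff_pairsReach_imp_dimOne` — hence **`EngineToGHL ↔ (reach → DimOne)`**: the crux
  of route LiouvilleMAD asks to remove exactly three restrictions from a proved-under-`PairsHL`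
  slice of `DimOne` — `t = 2 ↦ all t` (prime `k`-tuples), unit slopes `↦` all slopes `aᵢ n + bᵢ`,
  and bounded shift difference `↦` differences up to `2 L N` (the Siegel-hard layer,
  `Theorems/PairsToGHL/Negative/UnboundedSiegelZeros.lean`).  None of the three is touched by the
  hypothesis, which is why the crux is held behind stmt-Parity-0819.

References: B. Green, T. Tao, *Linear equations in primes*, Ann. of Math. 171 (2010), Conj. 1.2,
Example 1, (1.1)–(1.7) [GreenTao2010]; G. H. Hardy, J. E. Littlewood, Acta Math. 44 (1923)
[HardyLittlewood1923].
-/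

noncomputable section

namespace Summit.Parity.GeneralizedHardyLittlewood.Theorems.EngineToGHL

open Finset Filter MeasureTheory Literature.NumberTheory.Sieve
open scoped ArithmeticFunction.vonMangoldt Topology Classical
open Summit.Parity.GeneralizedHardyLittlewood.Theses
open Summit.Parity.GeneralizedHardyLittlewood.Theses.LiouvilleMAD
open Summit.Parity.GeneralizedHardyLittlewood.Cruxes.RelativeDimOne.TranslateAmplification
  (ordConnected_section section_subset_Icc volume_preimage_apply_zero card_shifts_bounds
    mem_iff_apply_zero_mem_section volume_ne_top_of_subset_Icc)

/-! ### The reach of `PairsHL`: bounded-shift unit-slope pairs, all intervals, shifts uniform up to `L N` -/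

/-- **`PairsHL` delivers the Green–Tao asymptotic for every unit-slope pair `(n + b₀, n + b₁)` with
BOUNDED shift difference `1 ≤ |b₁ - b₀| ≤ H`, uniformly in `|bᵢ| ≤ L N` and over all convex
`K ⊆ [-N, N]`** — the exact image of the route's target inside `DicksonFibration.DimOne` at `t = 2`:
translate to `(m, m + h)`, difference the partial sums `∑_{n ≤ M} Λ(n)Λ(n+h) = 𝔖 M + o(M)` at the
two ends of the block of integer points of the section of `K` (both ends `≤ (L+1)N`), and compare the
number of integer points with the length (`β_∞`, within `1`); `∏_p β_p = 𝔖({0,h})` by translation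
invariance of the local factors. [cite: GreenTao2010, Conj. 1.2, Example 1, (1.2), (1.4), (1.7)] -/
theorem pairsReach_of_pairsHL : LiouvilleShiftedTables.PairsHL → ∀ (H L : ℕ) (ε : ℝ), 0 < ε → ∃ N₀ : ℕ, ∀ N : ℕ, N₀ ≤ N → ∀ Ψ : Fin 2 → AffLinForm 1, IsNondegenerateSystem Ψ → affLinSize Ψ N ≤ L → (∀ i j, (Ψ i).coeff j = 1) → |(Ψ 1).const - (Ψ 0).const| ≤ H → ∀ K : Set (Fin 1 → ℝ), Convex ℝ K → K ⊆ realBox 1 N → |vonMangoldtSum Ψ K N - archFactor Ψ K * singularProduct Ψ| ≤ ε * N := by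
  intro hP H L ε hε
  -- uniform constants: `𝔖s` bounds every `𝔖({0,h})`, `h ≤ H`; `C` is the `PairsHL` constant at `δ`
  obtain ⟨𝔖s, h𝔖s⟩ : ∃ S : ℝ, ∑ k ∈ Icc 1 H, |singularSeries ({0, (k : ℤ)} : Finset ℤ)| = S :=
    ⟨_, rfl⟩
  have h𝔖s0 : 0 ≤ 𝔖s := by rw [← h𝔖s]; exact Finset.sum_nonneg fun _ _ => abs_nonneg _
  have hL2 : (0 : ℝ) < (L : ℝ) + 2 := by positivity
  obtain ⟨δ, hδ⟩ : ∃ δ : ℝ, ε / (4 * ((L : ℝ) + 2)) = δ := ⟨_, rfl⟩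
  have hδ0 : 0 < δ := by rw [← hδ]; positivity
  obtain ⟨C, hC0, hC⟩ := pairsHL_uniform_bound hP H δ hδ0
  refine ⟨⌈(2 * C + 𝔖s) * (2 / ε)⌉₊ + 1, fun N hN Ψ hnd hL hcoeff hH K hK hKN => ?_⟩
  have hN1 : 1 ≤ N := le_trans (Nat.le_add_left 1 _) hN
  have hNpos : (0 : ℝ) < N := by exact_mod_cast hN1
  have hNC : 2 * C + 𝔖s ≤ ε / 2 * N := by
    have h1 : (2 * C + 𝔖s) * (2 / ε) ≤ ⌈(2 * C + 𝔖s) * (2 / ε)⌉₊ := Nat.le_ceil _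
    have h2 : (⌈(2 * C + 𝔖s) * (2 / ε)⌉₊ : ℝ) + 1 ≤ N := by exact_mod_cast hN
    have h3 : (2 * C + 𝔖s) * (2 / ε) * (ε / 2) ≤ N * (ε / 2) :=
      mul_le_mul_of_nonneg_right (by linarith) (le_of_lt (half_pos hε))
    have h4 : (2 * C + 𝔖s) * (2 / ε) * (ε / 2) = 2 * C + 𝔖s := by
      field_simp
    linarith only [h1, h2, h3, h4]
  -- the shifts `b₀, b₁`, `c = min`, `e = max`, `h = e - c ∈ [1, H]`
  obtain ⟨b₀, hb₀⟩ : ∃ b : ℤ, (Ψ 0).const = b := ⟨_, rfl⟩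
  obtain ⟨b₁, hb₁⟩ : ∃ b : ℤ, (Ψ 1).const = b := ⟨_, rfl⟩
  obtain ⟨c, hc⟩ : ∃ c : ℤ, min b₀ b₁ = c := ⟨_, rfl⟩
  obtain ⟨e, he⟩ : ∃ e : ℤ, max b₀ b₁ = e := ⟨_, rfl⟩
  have hb : b₀ ≠ b₁ := by
    intro hbe
    have h := hnd.2 0 1 (by decide) 1 1 (fun n => by
      rw [eval_unitSlope (hcoeff 0), eval_unitSlope (hcoeff 1), hb₀, hb₁, hbe])
    exact one_ne_zero h.1
  have hce : c < e := by rw [← hc, ← he]; exact min_lt_max.mpr hb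
  have hcmin : c ≤ b₀ ∧ c ≤ b₁ := by rw [← hc]; exact ⟨min_le_left _ _, min_le_right _ _⟩
  have hemax : e = b₀ ∨ e = b₁ := by
    rcases le_total b₀ b₁ with hle | hle
    · exact Or.inr (by rw [← he, max_eq_right hle])
    · exact Or.inl (by rw [← he, max_eq_left hle])
  have hcb : c = b₀ ∨ c = b₁ := by
    rcases le_total b₀ b₁ with hle | hle
    · exact Or.inl (by rw [← hc, min_eq_left hle])
    · exact Or.inr (by rw [← hc, min_eq_right hle])
  obtain ⟨h, hh⟩ : ∃ h : ℕ, (e - c).toNat = h := ⟨_, rfl⟩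
  have hhe : (h : ℤ) = e - c := by rw [← hh]; exact Int.toNat_of_nonneg (by omega)
  have hh1 : 1 ≤ h := by omega
  have hh0 : h ≠ 0 := by omega
  have hhH : h ≤ H := by
    have h1 : e - c = |b₁ - b₀| := by
      rw [← he, ← hc]
      rcases le_total b₀ b₁ with hle | hle
      · rw [max_eq_right hle, min_eq_left hle, abs_of_nonneg (by omega)]
      · rw [max_eq_left hle, min_eq_right hle, abs_of_nonpos (by omega)]
        ring
    have h2 : (h : ℤ) ≤ H := by rw [hhe, h1, ← hb₀, ← hb₁]; exact hH
    exact_mod_cast h2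
  have hhe' : (h : ℤ) = max (Ψ 0).const (Ψ 1).const - min (Ψ 0).const (Ψ 1).const := by
    rw [hb₀, hb₁, hc, he, hhe]
  -- size: `|c| ≤ L N`
  have hcLN : |(c : ℝ)| ≤ L * N := by
    have h0 := abs_const_le_of_affLinSize_le hN1 hL 0
    have h1 := abs_const_le_of_affLinSize_le hN1 hL 1
    rw [hb₀] at h0
    rw [hb₁] at h1
    rcases hcb with hcb | hcb
    · rw [hcb]; exact h0
    · rw [hcb]; exact h1
  -- the section `J` of `K` and its positive part `J ∩ (-c, ∞)`
  obtain ⟨J, hJdef⟩ : ∃ J : Set ℝ, {y : ℝ | (fun _ : Fin 1 => y) ∈ K} = J := ⟨_, rfl⟩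
  have hJmem : ∀ y : ℝ, y ∈ J ↔ (fun _ : Fin 1 => y) ∈ K := fun y => by rw [← hJdef]; rfl
  have hJ : J.OrdConnected := by rw [← hJdef]; exact ordConnected_section hK
  have hJN : J ⊆ Set.Icc (-(N : ℝ)) N := by rw [← hJdef]; exact section_subset_Icc hKN
  obtain ⟨J', hJ'def⟩ : ∃ J' : Set ℝ, J ∩ Set.Ioi (-(c : ℝ)) = J' := ⟨_, rfl⟩
  have hJ' : J'.OrdConnected := by rw [← hJ'def]; exact hJ.inter Set.ordConnected_Ioi
  have hJ'N : J' ⊆ Set.Icc (-(N : ℝ)) N := by rw [← hJ'def]; exact fun y hy => hJN hy.1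
  have hJ'mem : ∀ y : ℝ, y ∈ J' ↔ y ∈ J ∧ -(c : ℝ) < y := fun y => by rw [← hJ'def]; rfl
  -- Step 1: the weighted sum is the block sum over the integer points of `J' = J ∩ (-c, ∞)`
  have hsum : vonMangoldtSum Ψ K N =
      ∑ m ∈ (Finset.Icc (-(N : ℤ)) N).filter (fun m : ℤ => (m : ℝ) ∈ J'),
        Λ ((m + c).toNat) * Λ ((m + c).toNat + h) := by
    rw [vonMangoldtSum_unitSlopePair Ψ hcoeff K N J hJmem, hb₀, hb₁]
    have hTT' : (Finset.Icc (-(N : ℤ)) N).filter (fun m : ℤ => (m : ℝ) ∈ J') =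
        ((Finset.Icc (-(N : ℤ)) N).filter (fun m : ℤ => (m : ℝ) ∈ J)).filter
          (fun m : ℤ => -(c : ℝ) < m) := by
      rw [Finset.filter_filter]
      exact Finset.filter_congr fun m _ => hJ'mem m
    rw [hTT']
    conv_rhs => rw [Finset.sum_filter]
    refine Finset.sum_congr rfl fun m _ => ?_
    have key : (Λ (m + b₀).toNat : ℝ) * Λ (m + b₁).toNat = Λ (m + c).toNat * Λ (m + e).toNat := by
      have := mul_pair_eq_mul_min_max (fun z : ℤ => (Λ z.toNat : ℝ)) m b₀ b₁
      simpa only [hc, he] using this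
    rw [key]
    split_ifs with hlt
    · have hlt' : -c < m := by exact_mod_cast hlt
      have h1 : (m + e).toNat = (m + c).toNat + h := by omega
      rw [h1]
    · have hle' : m ≤ -c := by
        have : (m : ℝ) ≤ -(c : ℝ) := not_lt.mp hlt
        exact_mod_cast this
      have h1 : (m + c).toNat = 0 := by omega
      rw [h1, ArithmeticFunction.map_zero, zero_mul]
  -- Step 2: `β_∞ = vol(J')`; Step 3: `∏_p β_p = 𝔖({0,h})`
  have harch : archFactor Ψ K = (volume J').toReal := by
    rw [archFactor_unitSlopePair Ψ hcoeff K J hJmem, hb₀, hb₁, hc, hJ'def]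
  have hsing : singularProduct Ψ = singularSeries ({0, (h : ℤ)} : Finset ℤ) :=
    singularProduct_unitSlopePair Ψ hcoeff hh0 hhe'
  rw [hsum, harch, hsing]
  have hvolT := abs_card_filter_sub_volume_le_one hJ' hJ'N
  have h𝔖le : |singularSeries ({0, (h : ℤ)} : Finset ℤ)| ≤ 𝔖s := by
    rw [← h𝔖s]
    exact Finset.single_le_sum (f := fun k : ℕ => |singularSeries ({0, (k : ℤ)} : Finset ℤ)|)
      (fun k _ => abs_nonneg _) (Finset.mem_Icc.mpr ⟨hh1, hhH⟩)
  -- Step 4: empty block, or a block `p, …, q` with `p + c ≥ 1`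
  rcases ((Finset.Icc (-(N : ℤ)) N).filter
      (fun m : ℤ => (m : ℝ) ∈ J')).eq_empty_or_nonempty with hTe | hTne
  · rw [hTe, Finset.sum_empty, zero_sub, abs_neg, abs_mul]
    rw [hTe, Finset.card_empty, Nat.cast_zero, zero_sub, abs_neg] at hvolT
    have hεN : 0 < ε * N := mul_pos hε hNpos
    calc |(volume J').toReal| * |singularSeries ({0, (h : ℤ)} : Finset ℤ)|
        ≤ 1 * 𝔖s := mul_le_mul hvolT h𝔖le (abs_nonneg _) zero_le_one
      _ = 𝔖s := one_mul _
      _ ≤ ε * N := by linarith only [hNC, hC0, hεN]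
  · -- the block
    have hTpq := filter_Icc_mem_eq_Icc hJ' hTne
    obtain ⟨p, hp⟩ : ∃ p : ℤ, ((Finset.Icc (-(N : ℤ)) N).filter
        (fun m : ℤ => (m : ℝ) ∈ J')).min' hTne = p := ⟨_, rfl⟩
    obtain ⟨q, hq⟩ : ∃ q : ℤ, ((Finset.Icc (-(N : ℤ)) N).filter
        (fun m : ℤ => (m : ℝ) ∈ J')).max' hTne = q := ⟨_, rfl⟩
    have hpT := Finset.min'_mem _ hTne
    have hqT := Finset.max'_mem _ hTne
    rw [hp] at hpT
    rw [hq] at hqT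
    have hpq : p ≤ q := by rw [← hp]; exact Finset.min'_le _ q hqT
    have hp' := Finset.mem_filter.mp hpT
    have hq' := Finset.mem_filter.mp hqT
    have hpc : 1 ≤ p + c := by
      have h1 : -(c : ℝ) < p := ((hJ'mem _).mp hp'.2).2
      have h2 : -c < p := by exact_mod_cast h1
      omega
    have hqN : q ≤ N := (Finset.mem_Icc.mp hq'.1).2
    rw [hp, hq] at hTpq
    rw [hTpq, sum_Icc_shift_eq h hpq hpc]
    rw [hTpq, Int.card_Icc] at hvolT
    -- the two ends `A ≤ B ≤ (L+1) N` of the block, in `ℝ`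
    obtain ⟨B, hB⟩ : ∃ B : ℕ, (q + c).toNat = B := ⟨_, rfl⟩
    obtain ⟨A, hA⟩ : ∃ A : ℕ, (p + c).toNat - 1 = A := ⟨_, rfl⟩
    rw [hB, hA]
    have hBr : (B : ℝ) = q + c := by
      have : (B : ℤ) = q + c := by rw [← hB]; exact Int.toNat_of_nonneg (by omega)
      exact_mod_cast this
    have hAr : (A : ℝ) = p + c - 1 := by
      have : (A : ℤ) = p + c - 1 := by rw [← hA]; omega
      exact_mod_cast this
    have hcardr : (((q + 1 - p).toNat : ℕ) : ℝ) = q + 1 - p := by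
      have : (((q + 1 - p).toNat : ℕ) : ℤ) = q + 1 - p := Int.toNat_of_nonneg (by omega)
      exact_mod_cast this
    rw [hcardr] at hvolT
    have hcabs := abs_le.mp hcLN
    have hqr : (q : ℝ) ≤ N := by exact_mod_cast hqN
    have hpqr : (p : ℝ) ≤ q := by exact_mod_cast hpq
    have hLN : ((L : ℝ) + 1) * N = L * N + N := by ring
    have hBle : (B : ℝ) ≤ ((L : ℝ) + 1) * N := by
      rw [hBr, hLN]
      linarith only [hcabs.2, hqr]
    have hAB : (A : ℝ) ≤ B := by
      rw [hAr, hBr]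
      linarith only [hpqr]
    exact block_arith (hC h hh1 hhH B) (hC h hh1 hhH A) h𝔖le hvolT (by rw [hBr, hAr]; ring)
      hAB hBle hNC hδ hε hNpos (Nat.cast_nonneg L) h𝔖s0

/-- Conversely the reach statement contains `PairsHL` (the system `(n, n + h)` on `K = [-N, N]`,
`H = h`, `L = 3`), so the two are EQUIVALENT. [cite: GreenTao2010, Example 1] -/
theorem pairsHL_of_pairsReach (hR : ∀ (H L : ℕ) (ε : ℝ), 0 < ε → ∃ N₀ : ℕ, ∀ N : ℕ, N₀ ≤ N → ∀ Ψ : Fin 2 → AffLinForm 1, IsNondegenerateSystem Ψ → affLinSize Ψ N ≤ L → (∀ i j, (Ψ i).coeff j = 1) → |(Ψ 1).const - (Ψ 0).const| ≤ H → ∀ K : Set (Fin 1 → ℝ), Convex ℝ K → K ⊆ realBox 1 N → |vonMangoldtSum Ψ K N - archFactor Ψ K * singularProduct Ψ| ≤ ε * N) :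
    LiouvilleShiftedTables.PairsHL := by
  intro h hh
  have hh0 : h ≠ 0 := by omega
  rw [Asymptotics.isLittleO_iff]
  intro ε hε
  obtain ⟨N₀, hN₀⟩ := hR h 3 ε hε
  rw [Filter.eventually_atTop]
  refine ⟨max N₀ h, fun N hN => ?_⟩
  have hNN₀ : N₀ ≤ N := le_of_max_le_left hN
  have hhN : h ≤ N := le_of_max_le_right hN
  have hNpos : 0 < N := lt_of_lt_of_le (by omega) hhN
  have hcoeff : ∀ i j, (shiftPairSystem (h : ℤ) i).coeff j = 1 := by
    intro i j
    fin_cases i <;> fin_cases j <;> rfl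
  have hconst : |(shiftPairSystem (h : ℤ) 1).const - (shiftPairSystem (h : ℤ) 0).const| ≤ ((h : ℕ) : ℤ) := by
    simp [shiftPairSystem]
  have hGN := hN₀ N hNN₀ (shiftPairSystem (h : ℤ))
    (PairsToGHL.Negative.isNondegenerateSystem_shiftPairSystem_iff.mpr (by exact_mod_cast hh0))
    (PairsToGHL.Negative.affLinSize_shiftPairSystem_le hNpos hhN) hcoeff hconst (realBox 1 N)
    (convex_Icc _ _) subset_rfl
  rw [PairsToGHL.Negative.vonMangoldtSum_shiftPairSystem,
    PairsToGHL.Negative.archFactor_shiftPairSystem,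
    ← PairsToGHL.singularSeries_pair_eq_singularProduct hh0] at hGN
  rw [Real.norm_eq_abs, Real.norm_eq_abs, Nat.abs_cast, mul_comm (singularSeries _) (N : ℝ)]
  exact hGN

/-- **`PairsHL` ↔ its reach**: binary Hardy–Littlewood at every fixed shift IS Green–Tao's
conjecture restricted to unit-slope pairs with bounded shift difference (all intervals, constants
uniform up to `L N`). [cite: GreenTao2010, Conj. 1.2 and Example 1] -/
theorem pairsHL_iff_pairsReach : LiouvilleShiftedTables.PairsHL ↔ ∀ (H L : ℕ) (ε : ℝ), 0 < ε → ∃ N₀ : ℕ, ∀ N : ℕ, N₀ ≤ N → ∀ Ψ : Fin 2 → AffLinForm 1, IsNondegenerateSystem Ψ → affLinSize Ψ N ≤ L → (∀ i j, (Ψ i).coeff j = 1) → |(Ψ 1).const - (Ψ 0).const| ≤ H → ∀ K : Set (Fin 1 → ℝ), Convex ℝ K → K ⊆ realBox 1 N → |vonMangoldtSum Ψ K N - archFactor Ψ K * singularProduct Ψ| ≤ ε * N :=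
  ⟨pairsReach_of_pairsHL, pairsHL_of_pairsReach⟩

/-- `DimOne` at `t = 2` contains the reach statement outright (drop the two slice hypotheses).
[cite: GreenTao2010, Conj. 1.2] -/
theorem pairsReach_of_dimOne (hD : DicksonFibration.DimOne) : ∀ (H L : ℕ) (ε : ℝ), 0 < ε → ∃ N₀ : ℕ, ∀ N : ℕ, N₀ ≤ N → ∀ Ψ : Fin 2 → AffLinForm 1, IsNondegenerateSystem Ψ → affLinSize Ψ N ≤ L → (∀ i j, (Ψ i).coeff j = 1) → |(Ψ 1).const - (Ψ 0).const| ≤ H → ∀ K : Set (Fin 1 → ℝ), Convex ℝ K → K ⊆ realBox 1 N → |vonMangoldtSum Ψ K N - archFactor Ψ K * singularProduct Ψ| ≤ ε * N := by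
  intro H L ε hε
  obtain ⟨N₀, hN₀⟩ := hD 2 L (by norm_num) ε hε
  exact ⟨N₀, fun N hN Ψ hΨ hL _ _ K hK hKN => hN₀ N hN Ψ hΨ hL K hK hKN⟩

/-- **The crux, with its hypothesis placed inside its conclusion.** `EngineToGHL` holds iff the
Green–Tao asymptotic for unit-slope pairs with BOUNDED shift difference implies it for ALL
one-dimensional systems (`DimOne`, stmt-Parity-0819): the three missing axes are `t ≥ 3` (prime
`k`-tuples), general slopes `aᵢ n + bᵢ`, and shift differences growing with `N` (up to `L N`,
Siegel-hard by `Theorems/PairsToGHL/Negative/UnboundedSiegelZeros.lean`). [folklore] -/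
theorem engineToGHL_iff_pairsReach_imp_dimOne : EngineToGHL ↔ ((∀ (H L : ℕ) (ε : ℝ), 0 < ε → ∃ N₀ : ℕ, ∀ N : ℕ, N₀ ≤ N → ∀ Ψ : Fin 2 → AffLinForm 1, IsNondegenerateSystem Ψ → affLinSize Ψ N ≤ L → (∀ i j, (Ψ i).coeff j = 1) → |(Ψ 1).const - (Ψ 0).const| ≤ H → ∀ K : Set (Fin 1 → ℝ), Convex ℝ K → K ⊆ realBox 1 N → |vonMangoldtSum Ψ K N - archFactor Ψ K * singularProduct Ψ| ≤ ε * N) → DicksonFibration.DimOne) := by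
  rw [engineToGHL_iff_pairsHL_imp_dimOne, pairsHL_iff_pairsReach]

end Summit.Parity.GeneralizedHardyLittlewood.Theorems.EngineToGHL

end
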